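import Mathlib.LinearAlgebra.Trace
import Mathlib.LinearAlgebra.PID
import Mathlib.LinearAlgebra.Projection
import Mathlib.LinearAlgebra.FiniteDimensional.Lemmas
import Mathlib.RingTheory.Nilpotent.Lemmas
import HarnessLib

/-!
# Tate's trace of finite-potent endomorphisms (Tate 1968, §1)

First layer of J. Tate's construction of the residues of differentials on curves by traces of
linear operators on infinite-dimensional vector spaces (*Residues of differentials on curves*,
Ann. Sci. ÉNS (4) 1 (1968) 149–159, §1 "Traces"). For a vector space `V` over a field `K`:

* `IsFinitePotent θ`: `θⁿ V` is finite-dimensional for some `n` (Tate, §1);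
* `fpTrace θ = Tr_V(θ)`: the trace of `θ` on the finite-dimensional invariant subspace `θⁿ V`
  (junk value `0` when `θ` is not finite-potent), and Tate's characterisation
  `fpTrace_eq_trace_restrict`: `Tr_V θ = Tr_W(θ|_W)` for **any** finite-dimensional invariant `W`
  with `θᵐ V ⊆ W` — proved from the finite-dimensional lemma
  `trace_eq_trace_restrict_of_range_pow_le` (the trace on `W` only sees `U ⊆ W` when a power of
  the operator maps `W` into `U`: the induced map on `W/U` is nilpotent);
* the rules **(T1)** `fpTrace_eq_trace` (finite-dimensional `V`), **(T2)** `fpTrace_prodMap`,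
  `fpTrace_eq_add_of_isCompl` (direct sums), **(T3)** `fpTrace_eq_zero_of_isNilpotent`,
  **(T5)** `fpTrace_mul_comm` (`Tr(φψ) = Tr(ψφ)` as soon as `ψφ` is finite-potent), invariance
  under isomorphisms `fpTrace_conj`;
* **(T4)** (linearity on a finite-potent subspace of `End V`) in the form used later: the class
  `SmallOn U θ` (`θV ⊆ U`, `dim θU < ∞`) of "`U`-small" operators — they are finite-potent with
  exponent `2`, closed under `+`, scalars, products, and two-sided multiplication by operators
  preserving `U`, and any two of them restrict to the finite-dimensional invariant subspace
  `θ₁U + θ₂U`, whence `SmallOn.fpTrace_add/sub/smul`, `SmallOn.fpTrace_mul_comm` and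
  `SmallOn.fpTrace_commutator` (`Tr[θ₁, θ₂] = 0`). Tate's `E₀(A)`-operators are `(A + W)`-small
  (file `TateResidue`).

Everything here is elementary linear algebra over Mathlib's `LinearMap.trace`; it is the input of
`Literature.LinearAlgebra.TateResidue.TateResidue` (abstract residue `res_A(f dg)`, residue theorem)
and, downstream, of the residue / Riemann–Hurwitz files of
`Literature.NumberTheory.DiophantineGeometry` (canonical divisor of an algebraic function field over
an algebraically closed field of characteristic `0`, towards `dim S₂(Γ₀(N)) = g(X₀(N))`).

Mathlib (v4.32.0) has no finite-potent operators / Tate trace (searched `finitePotent`,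
`FinitePotent`, `Tate` in `LinearAlgebra`): all declarations are new, in `namespace Literature.Tate`.
Mathlib anchors: `LinearMap.trace`, `LinearMap.trace_restrict_eq_of_forall_mem`,
`LinearMap.trace_comp_comm'`, `LinearMap.trace_conj'`, `LinearMap.trace_prodMap'`,
`LinearMap.isNilpotent_trace_of_isNilpotent`, `Submodule.projection`, `Module.End.pow_restrict`.

## References

* J. Tate, *Residues of differentials on curves*, Ann. Sci. École Norm. Sup. (4) 1 (1968),
  149–159, §1. [Tate1968]
-/

noncomputable section

open Module LinearMap Submodule

namespace Literature.LinearAlgebra.TateResidue.Tate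

universe u v

variable {K : Type u} {V : Type v} [Field K] [AddCommGroup V] [Module K V]

/-! ### A finite-dimensional lemma: the trace is insensitive to a nilpotent cokernel -/

section FiniteDimensional

variable {M : Type*} [AddCommGroup M] [Module K M]

/-- Iterates of `q ∘ φ` restricted to the complement `C`: if `U` is `φ`-invariant and `M = U ⊕ C` with
projection `q` onto `C`, then `((qφ)|_C)^i c = q(φ^i c)`. [folklore] -/
theorem pow_restrict_projection_comp_apply {φ : Module.End K M} {U C : Submodule K M}
    (hU : ∀ x ∈ U, φ x ∈ U) (hUC : IsCompl U C)
    (hq : ∀ x ∈ C, (C.projection U hUC.symm ∘ₗ φ) x ∈ C) (i : ℕ) (c : C) :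
    ((((C.projection U hUC.symm) ∘ₗ φ).restrict hq ^ i) c : M) = C.projection U hUC.symm ((φ ^ i) c) := by
  induction i with
  | zero => simp [projection_apply_of_mem_left hUC.symm c.2]
  | succ i ih =>
    rw [pow_succ', Module.End.mul_apply, coe_restrict_apply, LinearMap.comp_apply, ih, pow_succ',
      Module.End.mul_apply]
    set y : M := (φ ^ i) (c : M)
    conv_rhs => rw [← projection_add_projection_eq_self hUC y]
    rw [map_add, map_add]
    have h1 : C.projection U hUC.symm (φ (U.projection C hUC y)) = 0 :=
      (projection_apply_eq_zero_iff hUC.symm).2 (hU _ (projection_apply_mem hUC y))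
    rw [h1, zero_add]

variable [FiniteDimensional K M]

/-- If `U ⊆ M` is invariant under `φ` and some power of `φ` maps `M` into `U`, then the trace of `φ`
on `M` equals the trace of its restriction to `U` (the induced endomorphism of `M/U` is nilpotent).
[folklore] -/
theorem trace_eq_trace_restrict_of_range_pow_le (φ : Module.End K M) {U : Submodule K M}
    (hU : ∀ x ∈ U, φ x ∈ U) {j : ℕ} (hj : range (φ ^ j) ≤ U) :
    trace K M φ = trace K U (φ.restrict hU) := by
  obtain ⟨C, hUC⟩ := U.exists_isCompl
  set p : Module.End K M := U.projection C hUC with hp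
  set q : Module.End K M := C.projection U hUC.symm with hq_def
  have hsplit : φ = p ∘ₗ φ + q ∘ₗ φ := by
    rw [← add_comp, hp, hq_def, projection_add_projection_eq_id hUC, id_comp]
  have hpmem : ∀ x, (p ∘ₗ φ) x ∈ U := fun x ↦ projection_apply_mem hUC _
  have hqmem : ∀ x, (q ∘ₗ φ) x ∈ C := fun x ↦ projection_apply_mem hUC.symm _
  have h1 : trace K M (p ∘ₗ φ) = trace K U (φ.restrict hU) := by
    rw [← trace_restrict_eq_of_forall_mem U (p ∘ₗ φ) hpmem]
    congr 1
    ext ⟨x, hx⟩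
    simp only [coe_restrict_apply, LinearMap.comp_apply, hp]
    rw [projection_apply_of_mem_left hUC (hU x hx)]
  have h2 : trace K M (q ∘ₗ φ) = 0 := by
    rw [← trace_restrict_eq_of_forall_mem C (q ∘ₗ φ) hqmem]
    apply IsNilpotent.eq_zero
    apply isNilpotent_trace_of_isNilpotent
    refine ⟨j, ?_⟩
    ext c
    rw [pow_restrict_projection_comp_apply hU hUC (fun x _ ↦ hqmem x) j c]
    rw [LinearMap.zero_apply, ZeroMemClass.coe_zero]
    exact (projection_apply_eq_zero_iff hUC.symm).2 (hj (LinearMap.mem_range_self _ _))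
  conv_lhs => rw [hsplit]
  rw [map_add, h1, h2, add_zero]

end FiniteDimensional

/-! ### Finite-potent endomorphisms and their trace -/

/-- An endomorphism `θ` of a vector space `V` is **finite-potent** if `θⁿ V` is finite-dimensional
for some `n` (Tate 1968, §1). [cite: Tate1968, §1] -/
def IsFinitePotent (θ : Module.End K V) : Prop :=
  ∃ n : ℕ, FiniteDimensional K (range (θ ^ n))

/-- `θⁿ V` is `θ`-invariant. [folklore] -/
theorem mapsTo_range_pow (θ : Module.End K V) (n : ℕ) : ∀ x ∈ range (θ ^ n), θ x ∈ range (θ ^ n) := by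
  rintro _ ⟨y, rfl⟩
  refine ⟨θ y, ?_⟩
  rw [← Module.End.mul_apply, ← pow_succ, pow_succ', Module.End.mul_apply]

/-- **Tate's trace** `Tr_V θ` of a finite-potent endomorphism: the ordinary trace of `θ` on the
finite-dimensional invariant subspace `θⁿ V` (any `n` with `dim θⁿV < ∞`; independent of `n` by
`fpTrace_eq_trace_restrict`). Junk value `0` if `θ` is not finite-potent. [cite: Tate1968, §1] -/
def fpTrace (θ : Module.End K V) : K :=
  open scoped Classical in
  if h : IsFinitePotent θ then
    haveI := h.choose_spec
    trace K (range (θ ^ h.choose)) (θ.restrict (mapsTo_range_pow θ h.choose))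
  else 0

/-- `θⁿ⁺ᵐ V ⊆ θⁿ V`. [folklore] -/
theorem range_pow_add_le (θ : Module.End K V) (n m : ℕ) : range (θ ^ (n + m)) ≤ range (θ ^ n) := by
  rw [pow_add]; exact range_comp_le_range _ _

/-- `θⁿ⁺ᵐ V ⊆ θᵐ V`. [folklore] -/
theorem range_pow_add_le' (θ : Module.End K V) (n m : ℕ) : range (θ ^ (n + m)) ≤ range (θ ^ m) := by
  rw [add_comm]; exact range_pow_add_le θ m n

/-- Tate's characterisation of `Tr_V`: if `W` is a finite-dimensional `θ`-invariant subspace with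
`θᵐ V ⊆ W` for some `m`, then `Tr_V θ = Tr_W (θ|_W)` (Tate 1968, §1, remark after (T3)). [cite: Tate1968, §1] -/
theorem fpTrace_eq_trace_restrict {θ : Module.End K V} {W : Submodule K V} [FiniteDimensional K W]
    (hW : ∀ x ∈ W, θ x ∈ W) {m : ℕ} (hm : range (θ ^ m) ≤ W) :
    fpTrace θ = trace K W (θ.restrict hW) := by
  have h : IsFinitePotent θ := ⟨m, Submodule.finiteDimensional_of_le hm⟩
  rw [fpTrace, dif_pos h]
  haveI := h.choose_spec
  set n := h.choose
  -- both traces equal the trace on `θ^(n+m) V`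
  have key : ∀ (W' : Submodule K V) [FiniteDimensional K W'] (hW' : ∀ x ∈ W', θ x ∈ W')
      (hle : range (θ ^ (n + m)) ≤ W'),
      trace K W' (θ.restrict hW') =
        trace K (range (θ ^ (n + m))) (θ.restrict (mapsTo_range_pow θ (n + m))) := by
    intro W' _ hW' hle
    -- apply the finite-dimensional lemma inside `W'` with `U = θ^(n+m) V` viewed in `W'`
    set U : Submodule K W' := (range (θ ^ (n + m))).comap W'.subtype with hU
    have hUinv : ∀ x ∈ U, θ.restrict hW' x ∈ U := fun x hx ↦ by
      simp only [hU, mem_comap, coe_subtype, coe_restrict_apply] at hx ⊢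
      exact mapsTo_range_pow θ _ _ hx
    have hj : range ((θ.restrict hW') ^ (n + m)) ≤ U := by
      rintro _ ⟨y, rfl⟩
      simp only [hU, mem_comap, coe_subtype]
      rw [Module.End.pow_restrict, coe_restrict_apply]
      exact LinearMap.mem_range_self _ _
    rw [trace_eq_trace_restrict_of_range_pow_le (θ.restrict hW') hUinv hj]
    -- identify `U` with `range (θ^(n+m))`
    let e : U ≃ₗ[K] range (θ ^ (n + m)) := Submodule.comapSubtypeEquivOfLe hle
    rw [← trace_conj' _ e]
    congr 1
  rw [key (range (θ ^ n)) (mapsTo_range_pow θ n) (range_pow_add_le θ n m),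
    key W hW ((range_pow_add_le' θ n m).trans hm)]


/-- The junk value: `Tr_V θ = 0` if `θ` is not finite-potent. [folklore] -/
theorem fpTrace_of_not_isFinitePotent {θ : Module.End K V} (h : ¬ IsFinitePotent θ) : fpTrace θ = 0 := by
  rw [fpTrace, dif_neg h]

/-- `θ` is finite-potent as soon as some `θᵐ V` lies in a finite-dimensional subspace. [folklore] -/
theorem IsFinitePotent.of_range_pow_le {θ : Module.End K V} {W : Submodule K V} [FiniteDimensional K W]
    {m : ℕ} (hm : range (θ ^ m) ≤ W) : IsFinitePotent θ :=
  ⟨m, Submodule.finiteDimensional_of_le hm⟩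

/-- An endomorphism of finite rank is finite-potent. [folklore] -/
theorem IsFinitePotent.of_finiteDimensional_range (θ : Module.End K V)
    [FiniteDimensional K (range θ)] : IsFinitePotent θ :=
  ⟨1, by rwa [pow_one]⟩

/-- Every endomorphism of a finite-dimensional space is finite-potent. [folklore] -/
theorem IsFinitePotent.of_finiteDimensional [FiniteDimensional K V] (θ : Module.End K V) :
    IsFinitePotent θ :=
  ⟨0, inferInstance⟩

/-- A nilpotent endomorphism is finite-potent. [folklore] -/
theorem IsFinitePotent.of_isNilpotent {θ : Module.End K V} (h : IsNilpotent θ) : IsFinitePotent θ := by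
  obtain ⟨k, hk⟩ := h
  exact ⟨k, by rw [hk, range_zero]; infer_instance⟩

/-- **(T1)** On a finite-dimensional space Tate's trace is the ordinary trace (Tate 1968, §1 (T1)).
[cite: Tate1968, §1 (T1)] -/
theorem fpTrace_eq_trace [FiniteDimensional K V] (θ : Module.End K V) : fpTrace θ = trace K V θ := by
  rw [fpTrace_eq_trace_restrict (W := ⊤) (θ := θ) (fun x _ ↦ mem_top) (m := 0) le_top,
    ← trace_conj' _ (Submodule.topEquiv : (⊤ : Submodule K V) ≃ₗ[K] V)]
  congr 1

/-- **(T3)** The trace of a nilpotent endomorphism vanishes (Tate 1968, §1 (T3)). [cite: Tate1968, §1 (T3)] -/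
theorem fpTrace_eq_zero_of_isNilpotent {θ : Module.End K V} (h : IsNilpotent θ) : fpTrace θ = 0 := by
  obtain ⟨k, hk⟩ := h
  have hbot : range (θ ^ k) ≤ (⊥ : Submodule K V) := by rw [hk, range_zero]
  rw [fpTrace_eq_trace_restrict (W := ⊥) (fun x hx ↦ by rw [(mem_bot K).1 hx, map_zero]; exact zero_mem _)
    hbot]
  convert map_zero (trace K (⊥ : Submodule K V))
  exact Subsingleton.elim _ _

/-- `Tr_V 0 = 0`. [folklore] -/
@[simp]
theorem fpTrace_zero : fpTrace (0 : Module.End K V) = 0 :=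
  fpTrace_eq_zero_of_isNilpotent IsNilpotent.zero

/-! ### Invariance under isomorphisms -/

section conj

variable {V' : Type*} [AddCommGroup V'] [Module K V']

/-- `(e θ e⁻¹)ⁿ = e θⁿ e⁻¹`. [folklore] -/
theorem conj_pow (e : V ≃ₗ[K] V') (θ : Module.End K V) (n : ℕ) :
    e.conj θ ^ n = e.conj (θ ^ n) := by
  induction n with
  | zero => rw [pow_zero, pow_zero, Module.End.one_eq_id, Module.End.one_eq_id, LinearEquiv.conj_id]
  | succ n ih => rw [pow_succ, ih, pow_succ, Module.End.mul_eq_comp, Module.End.mul_eq_comp,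
      LinearEquiv.conj_comp]

/-- `(e θ e⁻¹) V' = e (θ V)`. [folklore] -/
theorem range_conj (e : V ≃ₗ[K] V') (θ : Module.End K V) :
    range (e.conj θ) = (range θ).map (e : V →ₗ[K] V') := by
  rw [LinearEquiv.conj_apply, range_comp, LinearEquiv.range, Submodule.map_top, range_comp]

/-- Finite-potency is invariant under isomorphisms. [folklore] -/
theorem IsFinitePotent.conj (e : V ≃ₗ[K] V') {θ : Module.End K V} (h : IsFinitePotent θ) :
    IsFinitePotent (e.conj θ) := by
  obtain ⟨n, hn⟩ := h
  refine ⟨n, ?_⟩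
  rw [conj_pow, range_conj]
  infer_instance

/-- Finite-potency is invariant under isomorphisms. [folklore] -/
theorem isFinitePotent_conj_iff (e : V ≃ₗ[K] V') {θ : Module.End K V} :
    IsFinitePotent (e.conj θ) ↔ IsFinitePotent θ := by
  refine ⟨fun h ↦ ?_, fun h ↦ h.conj e⟩
  simpa only [LinearEquiv.conj_symm_conj] using h.conj e.symm

/-- Tate's trace is invariant under isomorphisms: `Tr_{V'}(e θ e⁻¹) = Tr_V(θ)`. [folklore] -/
theorem fpTrace_conj (e : V ≃ₗ[K] V') (θ : Module.End K V) : fpTrace (e.conj θ) = fpTrace θ := by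
  by_cases h : IsFinitePotent θ
  · obtain ⟨n, hn⟩ := h
    have hW := mapsTo_range_pow θ n
    set W := range (θ ^ n)
    have hW' : ∀ x ∈ W.map (e : V →ₗ[K] V'), e.conj θ x ∈ W.map (e : V →ₗ[K] V') := by
      rintro _ ⟨y, hy, rfl⟩
      exact ⟨θ y, hW y hy, by simp [LinearEquiv.conj_apply_apply]⟩
    have hm : range ((e.conj θ) ^ n) ≤ W.map (e : V →ₗ[K] V') := by
      rw [conj_pow, range_conj]
    rw [fpTrace_eq_trace_restrict hW' hm, fpTrace_eq_trace_restrict hW le_rfl,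
      ← trace_conj' _ (e.submoduleMap W)]
    congr 1
  · rw [fpTrace_of_not_isFinitePotent h,
      fpTrace_of_not_isFinitePotent ((isFinitePotent_conj_iff e).not.mpr h)]

end conj

/-! ### (T5): `Tr(φψ) = Tr(ψφ)` -/

/-- **(T5)** If `ψφ` is finite-potent then so is `φψ`, and `Tr_V(φψ) = Tr_V(ψφ)` (Tate 1968, §1 (T5):
for large `m`, `φ` and `ψ` induce maps between `(ψφ)ᵐV` and `(φψ)ᵐV` whose two composites are the
two restrictions). [cite: Tate1968, §1 (T5)] -/
theorem fpTrace_mul_comm {φ ψ : Module.End K V} (h : IsFinitePotent (ψ * φ)) :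
    fpTrace (φ * ψ) = fpTrace (ψ * φ) := by
  obtain ⟨n, hn⟩ := h
  have hs₁ : SemiconjBy φ (ψ * φ) (φ * ψ) := by simp only [SemiconjBy, mul_assoc]
  have hs₂ : SemiconjBy ψ (φ * ψ) (ψ * φ) := by simp only [SemiconjBy, mul_assoc]
  haveI h₁ : FiniteDimensional K (range ((ψ * φ) ^ (n + 1))) :=
    Submodule.finiteDimensional_of_le (range_pow_add_le _ n 1)
  haveI h₂ : FiniteDimensional K (range ((φ * ψ) ^ (n + 1))) := by
    have : (φ * ψ) ^ (n + 1) = φ * (ψ * φ) ^ n * ψ := by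
      rw [pow_succ, (hs₁.pow_right n).eq, mul_assoc]
    rw [this]
    haveI : FiniteDimensional K (Submodule.map φ (range ((ψ * φ) ^ n))) := inferInstance
    have hle : range (φ * (ψ * φ) ^ n * ψ) ≤ Submodule.map φ (range ((ψ * φ) ^ n)) := by
      refine (range_comp_le_range ψ (φ * (ψ * φ) ^ n)).trans (le_of_eq ?_)
      rw [Module.End.mul_eq_comp, range_comp]
    exact Submodule.finiteDimensional_of_le hle
  set W₁ := range ((ψ * φ) ^ (n + 1))
  set W₂ := range ((φ * ψ) ^ (n + 1))
  have ha : ∀ x ∈ W₁, φ x ∈ W₂ := by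
    rintro _ ⟨y, rfl⟩
    refine ⟨φ y, ?_⟩
    rw [← Module.End.mul_apply, ← (hs₁.pow_right (n + 1)).eq, Module.End.mul_apply]
  have hb : ∀ x ∈ W₂, ψ x ∈ W₁ := by
    rintro _ ⟨y, rfl⟩
    refine ⟨ψ y, ?_⟩
    rw [← Module.End.mul_apply, ← (hs₂.pow_right (n + 1)).eq, Module.End.mul_apply]
  rw [fpTrace_eq_trace_restrict (mapsTo_range_pow (ψ * φ) (n + 1)) le_rfl,
    fpTrace_eq_trace_restrict (mapsTo_range_pow (φ * ψ) (n + 1)) le_rfl]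
  have e₁ : (ψ * φ).restrict (mapsTo_range_pow (ψ * φ) (n + 1)) = ψ.restrict hb ∘ₗ φ.restrict ha := rfl
  have e₂ : (φ * ψ).restrict (mapsTo_range_pow (φ * ψ) (n + 1)) = φ.restrict ha ∘ₗ ψ.restrict hb := rfl
  rw [e₁, e₂, trace_comp_comm']

/-! ### `U`-small operators: a convenient finite-potent class on which `Tr_V` is linear -/

/-- An endomorphism `θ` is **`U`-small** (for a subspace `U ⊆ V`) if `θV ⊆ U` and `θU` is
finite-dimensional. Such `θ` are finite-potent (`θ²V ⊆ θU`); any two `U`-small operators restrict to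
the finite-dimensional invariant subspace `θ₁U + θ₂U`, so `Tr_V` is additive on them and kills their
commutator. Tate's `E₀`-operators (those with `θV ≺ A`, `θA ≺ 0`) are `(A + W)`-small for a suitable
finite-dimensional `W` (see `TateResidue`). [folklore] -/
structure SmallOn (U : Submodule K V) (θ : Module.End K V) : Prop where
  /-- the image of `θ` lies in `U` -/
  range_le : range θ ≤ U
  /-- `θ U` is finite-dimensional -/
  finiteDimensional : FiniteDimensional K (U.map θ)

namespace SmallOn

variable {U : Submodule K V} {θ θ₁ θ₂ : Module.End K V}

/-- A `U`-small operator maps `U` into `U`. [folklore] -/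
theorem map_le (h : SmallOn U θ) : U.map θ ≤ U := (LinearMap.map_le_range).trans h.range_le

/-- `θ²V ⊆ θU` for `U`-small `θ`. [folklore] -/
theorem range_sq_le (h : SmallOn U θ) : range (θ ^ 2) ≤ U.map θ := by
  rw [pow_two, Module.End.mul_eq_comp, range_comp]; exact Submodule.map_mono h.range_le

/-- `U`-small operators are finite-potent. [folklore] -/
theorem isFinitePotent (h : SmallOn U θ) : IsFinitePotent θ := by
  haveI := h.finiteDimensional; exact .of_range_pow_le h.range_sq_le

/-- The trace of a `U`-small operator may be computed on any finite-dimensional invariant subspace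
containing `θU`. [folklore] -/
theorem fpTrace_eq (h : SmallOn U θ) {W : Submodule K V} [FiniteDimensional K W]
    (hW : ∀ x ∈ W, θ x ∈ W) (hUW : U.map θ ≤ W) : fpTrace θ = trace K W (θ.restrict hW) :=
  fpTrace_eq_trace_restrict hW (h.range_sq_le.trans hUW)

/-- A finite-rank operator with image in `U` is `U`-small. [folklore] -/
theorem of_finiteDimensional_range [FiniteDimensional K (range θ)] (hU : range θ ≤ U) :
    SmallOn U θ :=
  ⟨hU, Submodule.finiteDimensional_of_le LinearMap.map_le_range⟩

/-- `U`-small operators are closed under addition. [folklore] -/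
theorem add (h₁ : SmallOn U θ₁) (h₂ : SmallOn U θ₂) : SmallOn U (θ₁ + θ₂) where
  range_le := by
    rw [range_eq_map]
    exact (Submodule.map_add_le _ _ _).trans
      (sup_le ((Submodule.map_top θ₁).le.trans h₁.range_le) ((Submodule.map_top θ₂).le.trans h₂.range_le))
  finiteDimensional := by
    haveI := h₁.finiteDimensional; haveI := h₂.finiteDimensional
    exact Submodule.finiteDimensional_of_le (Submodule.map_add_le _ _ _)

/-- `(c θ) p ⊆ θ p`. [folklore] -/
theorem _root_.Literature.LinearAlgebra.TateResidue.Tate.map_smul_le' (c : K) (θ : Module.End K V) (p : Submodule K V) :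
    p.map (c • θ) ≤ p.map θ := by
  rintro _ ⟨y, hy, rfl⟩; exact Submodule.smul_mem _ c (Submodule.mem_map_of_mem hy)

/-- `U`-small operators are closed under scalars. [folklore] -/
theorem smul (c : K) (h : SmallOn U θ) : SmallOn U (c • θ) where
  range_le := by
    rintro _ ⟨y, rfl⟩; exact Submodule.smul_mem _ c (h.range_le (mem_range_self θ y))
  finiteDimensional := by
    haveI := h.finiteDimensional
    exact Submodule.finiteDimensional_of_le (map_smul_le' c θ U)

/-- `U`-small operators are closed under negation. [folklore] -/
theorem neg (h : SmallOn U θ) : SmallOn U (-θ) := by simpa using h.smul (-1)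

/-- `U`-small operators are closed under subtraction. [folklore] -/
theorem sub (h₁ : SmallOn U θ₁) (h₂ : SmallOn U θ₂) : SmallOn U (θ₁ - θ₂) := by
  simpa [sub_eq_add_neg] using h₁.add h₂.neg

/-- `U`-small operators are closed under composition. [folklore] -/
theorem mul (h₁ : SmallOn U θ₁) (h₂ : SmallOn U θ₂) : SmallOn U (θ₁ * θ₂) where
  range_le := (range_comp_le_range _ _).trans h₁.range_le
  finiteDimensional := by
    haveI := h₂.finiteDimensional
    rw [Module.End.mul_eq_comp, Submodule.map_comp]; infer_instance

/-- `U`-small operators form a left ideal over operators preserving `U`. [folklore] -/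
theorem mul_left (h : SmallOn U θ) (ψ : Module.End K V) (hψ : U.map ψ ≤ U) : SmallOn U (ψ * θ) where
  range_le := by
    rw [Module.End.mul_eq_comp, range_comp]; exact (Submodule.map_mono h.range_le).trans hψ
  finiteDimensional := by
    haveI := h.finiteDimensional
    rw [Module.End.mul_eq_comp, Submodule.map_comp]; infer_instance

/-- `U`-small operators form a right ideal over operators preserving `U`. [folklore] -/
theorem mul_right (h : SmallOn U θ) (ψ : Module.End K V) (hψ : U.map ψ ≤ U) : SmallOn U (θ * ψ) where
  range_le := (range_comp_le_range _ _).trans h.range_le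
  finiteDimensional := by
    haveI := h.finiteDimensional
    rw [Module.End.mul_eq_comp, Submodule.map_comp]
    exact Submodule.finiteDimensional_of_le (Submodule.map_mono hψ)

/-- `θ₁` preserves `θ₁U + θ₂U`. [folklore] -/
theorem range_le_sup_left (h₁ : SmallOn U θ₁) (h₂ : SmallOn U θ₂) :
    ∀ x ∈ U.map θ₁ ⊔ U.map θ₂, θ₁ x ∈ U.map θ₁ ⊔ U.map θ₂ := fun _ hx ↦
  le_sup_left (b := U.map θ₂) (Submodule.mem_map_of_mem (sup_le h₁.map_le h₂.map_le hx))

/-- `θ₂` preserves `θ₁U + θ₂U`. [folklore] -/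
theorem range_le_sup_right (h₁ : SmallOn U θ₁) (h₂ : SmallOn U θ₂) :
    ∀ x ∈ U.map θ₁ ⊔ U.map θ₂, θ₂ x ∈ U.map θ₁ ⊔ U.map θ₂ := fun _ hx ↦
  le_sup_right (a := U.map θ₁) (Submodule.mem_map_of_mem (sup_le h₁.map_le h₂.map_le hx))

/-- **(T4)** for `U`-small operators: `Tr_V(θ₁ + θ₂) = Tr_V θ₁ + Tr_V θ₂` (Tate 1968, §1 (T4)).
[cite: Tate1968, §1 (T4)] -/
theorem fpTrace_add (h₁ : SmallOn U θ₁) (h₂ : SmallOn U θ₂) :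
    fpTrace (θ₁ + θ₂) = fpTrace θ₁ + fpTrace θ₂ := by
  haveI := h₁.finiteDimensional; haveI := h₂.finiteDimensional
  have hW₁ := range_le_sup_left h₁ h₂
  have hW₂ := range_le_sup_right h₁ h₂
  have hW : ∀ x ∈ U.map θ₁ ⊔ U.map θ₂, (θ₁ + θ₂) x ∈ U.map θ₁ ⊔ U.map θ₂ := fun x hx ↦
    add_mem (hW₁ x hx) (hW₂ x hx)
  rw [h₁.fpTrace_eq hW₁ le_sup_left, h₂.fpTrace_eq hW₂ le_sup_right,
    (h₁.add h₂).fpTrace_eq hW (Submodule.map_add_le _ _ _), ← map_add]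
  rfl

/-- `Tr_V(c θ) = c Tr_V θ` for `U`-small `θ`. [folklore] -/
theorem fpTrace_smul (c : K) (h : SmallOn U θ) : fpTrace (c • θ) = c * fpTrace θ := by
  haveI := h.finiteDimensional
  have hW : ∀ x ∈ U.map θ, θ x ∈ U.map θ := fun x hx ↦ Submodule.mem_map_of_mem (h.map_le hx)
  have hW' : ∀ x ∈ U.map θ, (c • θ) x ∈ U.map θ := fun x hx ↦ Submodule.smul_mem _ c (hW x hx)
  rw [h.fpTrace_eq hW le_rfl, (h.smul c).fpTrace_eq hW' (map_smul_le' c θ U),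
    ← smul_eq_mul, ← map_smul]
  rfl

/-- `Tr_V(-θ) = -Tr_V θ` for `U`-small `θ`. [folklore] -/
theorem fpTrace_neg (h : SmallOn U θ) : fpTrace (-θ) = -fpTrace θ := by
  simpa using fpTrace_smul (-1) h

/-- `Tr_V(θ₁ - θ₂) = Tr_V θ₁ - Tr_V θ₂` for `U`-small operators. [folklore] -/
theorem fpTrace_sub (h₁ : SmallOn U θ₁) (h₂ : SmallOn U θ₂) :
    fpTrace (θ₁ - θ₂) = fpTrace θ₁ - fpTrace θ₂ := by
  rw [sub_eq_add_neg, fpTrace_add h₁ h₂.neg, fpTrace_neg h₂, sub_eq_add_neg]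

/-- For `U`-small `θ₁, θ₂`: `Tr_V(θ₁θ₂) = Tr_V(θ₂θ₁)` (both restrict to `θ₁U + θ₂U`). [folklore] -/
theorem fpTrace_mul_comm (h₁ : SmallOn U θ₁) (h₂ : SmallOn U θ₂) :
    fpTrace (θ₁ * θ₂) = fpTrace (θ₂ * θ₁) := by
  haveI := h₁.finiteDimensional; haveI := h₂.finiteDimensional
  have hW₁ := range_le_sup_left h₁ h₂
  have hW₂ := range_le_sup_right h₁ h₂
  have hW₁₂ : ∀ x ∈ U.map θ₁ ⊔ U.map θ₂, (θ₁ * θ₂) x ∈ U.map θ₁ ⊔ U.map θ₂ := fun x hx ↦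
    hW₁ _ (hW₂ x hx)
  have hW₂₁ : ∀ x ∈ U.map θ₁ ⊔ U.map θ₂, (θ₂ * θ₁) x ∈ U.map θ₁ ⊔ U.map θ₂ := fun x hx ↦
    hW₂ _ (hW₁ x hx)
  have hU₁₂ : U.map (θ₁ * θ₂) ≤ U.map θ₁ ⊔ U.map θ₂ := by
    rw [Module.End.mul_eq_comp, Submodule.map_comp]
    exact (Submodule.map_mono h₂.map_le).trans le_sup_left
  have hU₂₁ : U.map (θ₂ * θ₁) ≤ U.map θ₁ ⊔ U.map θ₂ := by
    rw [Module.End.mul_eq_comp, Submodule.map_comp]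
    exact (Submodule.map_mono h₁.map_le).trans le_sup_right
  rw [(h₁.mul h₂).fpTrace_eq hW₁₂ hU₁₂, (h₂.mul h₁).fpTrace_eq hW₂₁ hU₂₁]
  have e₁ : (θ₁ * θ₂).restrict hW₁₂ = θ₁.restrict hW₁ * θ₂.restrict hW₂ := rfl
  have e₂ : (θ₂ * θ₁).restrict hW₂₁ = θ₂.restrict hW₂ * θ₁.restrict hW₁ := rfl
  rw [e₁, e₂, LinearMap.trace_mul_comm]

/-- For `U`-small `θ₁, θ₂` the commutator has trace zero. [folklore] -/
theorem fpTrace_commutator (h₁ : SmallOn U θ₁) (h₂ : SmallOn U θ₂) :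
    fpTrace (θ₁ * θ₂ - θ₂ * θ₁) = 0 := by
  rw [fpTrace_sub (h₁.mul h₂) (h₂.mul h₁), fpTrace_mul_comm h₁ h₂, sub_self]

end SmallOn

/-! ### Direct sums -/

section prod

variable {V₁ V₂ : Type*} [AddCommGroup V₁] [Module K V₁] [AddCommGroup V₂] [Module K V₂]

/-- The subspace `p × q ⊆ V₁ × V₂` is the product of `p` and `q` (Mathlib has `Submodule.prod`
but, as far as we could find (searched `prodEquiv`, `prod_equiv` in `Submodule`), not this
tautological isomorphism). [folklore] -/
def prodSubmoduleEquiv (p : Submodule K V₁) (q : Submodule K V₂) : ↥(p.prod q) ≃ₗ[K] (p × q) where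
  toFun x := (⟨x.1.1, (Submodule.mem_prod.1 x.2).1⟩, ⟨x.1.2, (Submodule.mem_prod.1 x.2).2⟩)
  invFun y := ⟨(y.1, y.2), Submodule.mem_prod.2 ⟨y.1.2, y.2.2⟩⟩
  map_add' _ _ := rfl
  map_smul' _ _ := rfl
  left_inv _ := rfl
  right_inv _ := rfl

/-- `(θ₁ × θ₂)ⁿ = θ₁ⁿ × θ₂ⁿ`. [folklore] -/
theorem prodMap_pow (θ₁ : Module.End K V₁) (θ₂ : Module.End K V₂) (n : ℕ) :
    (θ₁.prodMap θ₂) ^ n = (θ₁ ^ n).prodMap (θ₂ ^ n) := by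
  induction n with
  | zero => rw [pow_zero, pow_zero, pow_zero, LinearMap.prodMap_one]
  | succ n ih => rw [pow_succ, ih, pow_succ, pow_succ, LinearMap.prodMap_mul]

/-- **(T2)**, product form: `Tr_{V₁ × V₂}(θ₁ × θ₂) = Tr θ₁ + Tr θ₂` (Tate 1968, §1 (T2)).
[cite: Tate1968, §1 (T2)] -/
theorem fpTrace_prodMap {θ₁ : Module.End K V₁} {θ₂ : Module.End K V₂} (h₁ : IsFinitePotent θ₁)
    (h₂ : IsFinitePotent θ₂) : fpTrace (θ₁.prodMap θ₂) = fpTrace θ₁ + fpTrace θ₂ := by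
  obtain ⟨n₁, hn₁⟩ := h₁
  obtain ⟨n₂, hn₂⟩ := h₂
  haveI : FiniteDimensional K (range (θ₁ ^ (n₁ + n₂))) :=
    Submodule.finiteDimensional_of_le (range_pow_add_le θ₁ n₁ n₂)
  haveI : FiniteDimensional K (range (θ₂ ^ (n₁ + n₂))) :=
    Submodule.finiteDimensional_of_le (range_pow_add_le' θ₂ n₁ n₂)
  set n := n₁ + n₂
  set W₁ := range (θ₁ ^ n)
  set W₂ := range (θ₂ ^ n)
  let e := prodSubmoduleEquiv W₁ W₂
  haveI : FiniteDimensional K (W₁.prod W₂) := LinearEquiv.finiteDimensional e.symm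
  have hW : ∀ x ∈ W₁.prod W₂, θ₁.prodMap θ₂ x ∈ W₁.prod W₂ := fun x hx ↦
    Submodule.mem_prod.2
      ⟨mapsTo_range_pow θ₁ n _ (Submodule.mem_prod.1 hx).1,
        mapsTo_range_pow θ₂ n _ (Submodule.mem_prod.1 hx).2⟩
  have hm : range ((θ₁.prodMap θ₂) ^ n) ≤ W₁.prod W₂ := by
    rintro _ ⟨y, rfl⟩
    rw [prodMap_pow]
    exact Submodule.mem_prod.2 ⟨mem_range_self _ _, mem_range_self _ _⟩
  rw [fpTrace_eq_trace_restrict hW hm, fpTrace_eq_trace_restrict (mapsTo_range_pow θ₁ n) le_rfl,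
    fpTrace_eq_trace_restrict (mapsTo_range_pow θ₂ n) le_rfl, ← trace_prodMap', ← trace_conj' _ e]
  congr 1

end prod

/-- An endomorphism preserving both summands of `V = V₁ ⊕ V₂` is conjugate, by
`Submodule.prodEquivOfIsCompl`, to the product of its two restrictions. [folklore] -/
theorem conj_prodMap_restrict {θ : Module.End K V} {V₁ V₂ : Submodule K V} (hc : IsCompl V₁ V₂)
    (h₁ : ∀ x ∈ V₁, θ x ∈ V₁) (h₂ : ∀ x ∈ V₂, θ x ∈ V₂) :
    (Submodule.prodEquivOfIsCompl V₁ V₂ hc).conj ((θ.restrict h₁).prodMap (θ.restrict h₂)) = θ := by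
  conv_rhs => rw [← LinearEquiv.conj_conj_symm (Submodule.prodEquivOfIsCompl V₁ V₂ hc) θ]
  congr 1
  apply LinearMap.prod_ext
  · ext x
    · have := Submodule.prodEquivOfIsCompl_symm_apply_left (p := V₁) (q := V₂) hc (⟨θ x, h₁ x x.2⟩ : V₁)
      simp only [LinearMap.comp_apply, LinearEquiv.conj_apply_apply] at this ⊢
      simp [this]
    · have := Submodule.prodEquivOfIsCompl_symm_apply_left (p := V₁) (q := V₂) hc (⟨θ x, h₁ x x.2⟩ : V₁)
      simp only [LinearMap.comp_apply, LinearEquiv.conj_apply_apply] at this ⊢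
      simp [this]
  · ext x
    · have := Submodule.prodEquivOfIsCompl_symm_apply_right (p := V₁) (q := V₂) hc (⟨θ x, h₂ x x.2⟩ : V₂)
      simp only [LinearMap.comp_apply, LinearEquiv.conj_apply_apply] at this ⊢
      simp [this]
    · have := Submodule.prodEquivOfIsCompl_symm_apply_right (p := V₁) (q := V₂) hc (⟨θ x, h₂ x x.2⟩ : V₂)
      simp only [LinearMap.comp_apply, LinearEquiv.conj_apply_apply] at this ⊢
      simp [this]

/-- **(T2)**, internal form: if `V = V₁ ⊕ V₂` with both summands `θ`-invariant and `θ` finite-potent on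
each, then `Tr_V θ = Tr_{V₁} θ + Tr_{V₂} θ` (Tate 1968, §1 (T2)). [cite: Tate1968, §1 (T2)] -/
theorem fpTrace_eq_add_of_isCompl {θ : Module.End K V} {V₁ V₂ : Submodule K V} (hc : IsCompl V₁ V₂)
    (h₁ : ∀ x ∈ V₁, θ x ∈ V₁) (h₂ : ∀ x ∈ V₂, θ x ∈ V₂)
    (hf₁ : IsFinitePotent (θ.restrict h₁)) (hf₂ : IsFinitePotent (θ.restrict h₂)) :
    fpTrace θ = fpTrace (θ.restrict h₁) + fpTrace (θ.restrict h₂) := by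
  rw [← fpTrace_prodMap hf₁ hf₂, ← fpTrace_conj (Submodule.prodEquivOfIsCompl V₁ V₂ hc),
    conj_prodMap_restrict hc h₁ h₂]

end Literature.LinearAlgebra.TateResidue.Tate
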